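import Literature.NumberTheory.Sieve.IdealSieveSums
import Literature.NumberTheory.Sieve.MaynardTao
import HarnessLib

/-!
# The Maynard–Tao sieve weights over `𝓞_K`: `λ_𝔡 ↔ y_𝔯` (Castillo et al. §2.2 / Maynard Lemma 5.1)

Topic `Literature/NumberTheory/Sieve`. The number-field port of the tree's
`Sieve/MaynardSieveWeights.lean` (J. Maynard, *Small gaps between primes*, Ann. of Math. 181 (2015),
Lemma 5.1 and §6), as used by A. Castillo, C. Hall, R. J. Lemke Oliver, P. Pollack, L. Thompson,
*Bounded gaps between primes in number fields and function fields*, Proc. AMS 143 (2015),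
arXiv:1403.5808, §2.2 ("we define the weights `λ_{𝔡₁,…,𝔡_k}` … in terms of `y_{𝔯₁,…,𝔯_k}` … this
change of variables is invertible"): integers are replaced by nonzero ideals of `𝓞_K`, `d` by `N𝔡`,
`φ(d)` by `φ(𝔡) = N𝔡 ∏_{𝔭∣𝔡}(1 − 1/N𝔭)`, `μ` by the Möbius function of ideals, and coprimality to
`W` by comaximality with the ideal `𝔴`. Everything in this file is PROVED.

* (`Literature.NumberTheory.LFunctions`) `Ideal.isRelPrime_iff_sup_eq_top`,
  `idealMoebius_mul_of_coprime` (`μ(𝔯𝔪) = μ(𝔯)μ(𝔪)` for comaximal ideals),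
  `sum_idealMoebius_filter_dvd_of_squarefree` (`∑_{𝔡∣𝔫, 𝔯∣𝔡} μ(𝔡) = μ(𝔯)[𝔫 = 𝔯]`, `𝔫` square-free);
* (`Literature.NumberTheory.Sieve.MaynardNF`) `idealTotient`, `box K k R` (`0 < N𝔯ᵢ ≤ R`),
  **`weight`** (`λ_𝔡 = (∏ μ(𝔡ᵢ)N𝔡ᵢ) ∑_{𝔡ᵢ∣𝔯ᵢ, (𝔯ᵢ,𝔴)=1} μ(∏𝔯ᵢ)²/∏φ(𝔯ᵢ) F(log N𝔯ᵢ/log R)`),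
`sum_divisors_idealTotient` (`∑_{𝔡∣𝔫} φ(𝔡) = N𝔫`),
  **`Y`** (`y_𝔯 = (∏ μ(𝔯ᵢ)φ(𝔯ᵢ)) ∑_{𝔯ᵢ∣𝔡ᵢ} λ_𝔡/∏N𝔡ᵢ`), and the inversion **`Y_eq`**:
  `y_𝔯 = μ(∏𝔯ᵢ)² 1[(𝔯ᵢ,𝔴)=1] F(log N𝔯ᵢ/log R)` on the box, `Y_eq_zero_of_not_mem` off it.

## References

* A. Castillo et al., arXiv:1403.5808, §2.2. [cite: CastilloEtAl2015, §2.2]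
* J. Maynard, Ann. of Math. 181 (2015), Lemma 5.1, §6. [cite: MaynardAnnals2015, Lemma 5.1]
-/

noncomputable section

open Finset UniqueFactorizationMonoid
open scoped NumberField Classical

namespace Literature.NumberTheory.LFunctions

variable {R : Type*} [CommRing R] [IsDedekindDomain R]

/-- In a Dedekind domain, ideals are relatively prime iff they are comaximal. [folklore] -/
theorem Ideal.isRelPrime_iff_sup_eq_top {𝔯 𝔪 : Ideal R} : IsRelPrime 𝔯 𝔪 ↔ 𝔯 ⊔ 𝔪 = ⊤ := by
  constructor
  · intro h
    have hd : 𝔯 ⊔ 𝔪 ∣ 𝔯 := Ideal.dvd_iff_le.2 le_sup_left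
    have hd' : 𝔯 ⊔ 𝔪 ∣ 𝔪 := Ideal.dvd_iff_le.2 le_sup_right
    exact Ideal.isUnit_iff.1 (h hd hd')
  · intro h d hd hd'
    rw [Ideal.isUnit_iff, eq_top_iff, ← h]
    exact sup_le (Ideal.dvd_iff_le.1 hd) (Ideal.dvd_iff_le.1 hd')

/-- **`μ` is multiplicative on comaximal ideals**: `μ(𝔯𝔪) = μ(𝔯) μ(𝔪)` if `𝔯 + 𝔪 = (1)`.
[folklore] -/
theorem idealMoebius_mul_of_coprime {𝔯 𝔪 : Ideal R} (h : 𝔯 ⊔ 𝔪 = ⊤) :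
    idealMoebius (𝔯 * 𝔪) = idealMoebius 𝔯 * idealMoebius 𝔪 := by
  by_cases hsq : Squarefree (𝔯 * 𝔪)
  · have h𝔯 := hsq.of_mul_left
    have h𝔪 := hsq.of_mul_right
    have h0 : 𝔯 * 𝔪 ≠ 0 := hsq.ne_zero
    have h𝔯0 : 𝔯 ≠ 0 := left_ne_zero_of_mul h0
    have h𝔪0 : 𝔪 ≠ 0 := right_ne_zero_of_mul h0
    rw [idealMoebius_apply_of_squarefree hsq, idealMoebius_apply_of_squarefree h𝔯,
      idealMoebius_apply_of_squarefree h𝔪, normalizedFactors_mul h𝔯0 h𝔪0, Multiset.card_add, pow_add]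
  · rw [idealMoebius_apply_of_not_squarefree hsq]
    rw [squarefree_mul_iff, Ideal.isRelPrime_iff_sup_eq_top] at hsq
    push Not at hsq
    by_cases h𝔯 : Squarefree 𝔯
    · rw [idealMoebius_apply_of_not_squarefree (hsq h h𝔯), mul_zero]
    · rw [idealMoebius_apply_of_not_squarefree h𝔯, zero_mul]

/-- A square-free product is a product of comaximal square-free ideals. [folklore] -/
theorem sup_eq_top_of_squarefree_mul {𝔯 𝔪 : Ideal R} (h : Squarefree (𝔯 * 𝔪)) : 𝔯 ⊔ 𝔪 = ⊤ :=
  Ideal.isRelPrime_iff_sup_eq_top.1 (squarefree_mul_iff.1 h).1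

/-- **The one-variable Möbius inversion behind Maynard's Lemma 5.1, over ideals**: for a nonzero
square-free ideal `𝔫`, any `𝔯`, and `D` the finset of divisors of `𝔫`,
`∑_{𝔡 ∣ 𝔫, 𝔯 ∣ 𝔡} μ(𝔡) = μ(𝔯) · [𝔫 = 𝔯]` (write `𝔡 = 𝔯𝔢` with `𝔢 ∣ 𝔫/𝔯`, `μ(𝔯𝔢) = μ(𝔯)μ(𝔢)`,
`∑_{𝔢 ∣ 𝔪} μ(𝔢) = [𝔪 = (1)]`). [folklore] -/
theorem sum_idealMoebius_filter_dvd_of_squarefree {𝔫 : Ideal R} (hsq : Squarefree 𝔫) (𝔯 : Ideal R)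
    {D : Finset (Ideal R)} (hD : ∀ 𝔡, 𝔡 ∈ D ↔ 𝔡 ∣ 𝔫) :
    ∑ 𝔡 ∈ D.filter (fun 𝔡 => 𝔯 ∣ 𝔡), idealMoebius 𝔡 = if 𝔫 = 𝔯 then idealMoebius 𝔯 else 0 := by
  have h𝔫0 : 𝔫 ≠ 0 := hsq.ne_zero
  by_cases h𝔯𝔫 : 𝔯 ∣ 𝔫
  · obtain ⟨𝔪, rfl⟩ := h𝔯𝔫
    have h𝔯0 : 𝔯 ≠ 0 := left_ne_zero_of_mul h𝔫0
    have h𝔪0 : 𝔪 ≠ 0 := right_ne_zero_of_mul h𝔫0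
    have hcop : 𝔯 ⊔ 𝔪 = ⊤ := sup_eq_top_of_squarefree_mul hsq
    -- divisors of `𝔯𝔪` divisible by `𝔯` are the `𝔯𝔢`, `𝔢 ∣ 𝔪`
    set D𝔪 := D.filter (· ∣ 𝔪) with hD𝔪
    have hD𝔪mem : ∀ 𝔢, 𝔢 ∈ D𝔪 ↔ 𝔢 ∣ 𝔪 := by
      intro 𝔢
      rw [hD𝔪, Finset.mem_filter, hD]
      exact ⟨fun h => h.2, fun h => ⟨h.trans (dvd_mul_left 𝔪 𝔯), h⟩⟩
    have hset : D.filter (fun 𝔡 => 𝔯 ∣ 𝔡) = D𝔪.image (fun 𝔢 => 𝔯 * 𝔢) := by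
      ext 𝔡
      simp only [Finset.mem_filter, Finset.mem_image, hD, hD𝔪mem]
      constructor
      · rintro ⟨hd, ⟨𝔢, rfl⟩⟩
        exact ⟨𝔢, (mul_dvd_mul_iff_left h𝔯0).1 hd, rfl⟩
      · rintro ⟨𝔢, he, rfl⟩
        exact ⟨mul_dvd_mul_left 𝔯 he, dvd_mul_right _ _⟩
    rw [hset, Finset.sum_image fun 𝔢₁ _ 𝔢₂ _ h => mul_left_cancel₀ h𝔯0 h]
    have hmul : ∀ 𝔢 ∈ D𝔪, idealMoebius (𝔯 * 𝔢) = idealMoebius 𝔯 * idealMoebius 𝔢 := by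
      intro 𝔢 he
      refine idealMoebius_mul_of_coprime ?_
      -- `𝔯 + 𝔢 = (1)` since `𝔢 ∣ 𝔪` and `𝔯 + 𝔪 = (1)`
      rw [eq_top_iff, ← hcop]
      exact sup_le_sup_left (Ideal.le_of_dvd ((hD𝔪mem 𝔢).1 he)) _
    rw [Finset.sum_congr rfl hmul, ← Finset.mul_sum,
      sum_idealMoebius_of_dvd (by rwa [Ne, ← Ideal.zero_eq_bot]) hD𝔪mem]
    by_cases h𝔪1 : 𝔪 = ⊤
    · subst h𝔪1
      simp
    · rw [if_neg h𝔪1, mul_zero, if_neg]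
      intro h
      apply h𝔪1
      have : 𝔯 * 𝔪 = 𝔯 * ⊤ := by rw [Ideal.mul_top]; exact h
      exact mul_left_cancel₀ h𝔯0 this
  · have hempty : D.filter (fun 𝔡 => 𝔯 ∣ 𝔡) = ∅ := by
      ext 𝔡
      simp only [Finset.mem_filter, hD, Finset.notMem_empty, iff_false, not_and]
      exact fun hd hrd => h𝔯𝔫 (hrd.trans hd)
    rw [hempty, Finset.sum_empty, if_neg]
    rintro rfl
    exact h𝔯𝔫 dvd_rfl

end Literature.NumberTheory.LFunctions

namespace Literature.NumberTheory.Sieve.MaynardNF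

open UniqueFactorizationMonoid Literature.NumberTheory.LFunctions
  Literature.NumberTheory.LFunctions.NumberField

variable (K : Type*) [Field K] [NumberField K]

/-! ### The totient of an ideal, the box, the weights `λ_𝔡` and the variables `y_𝔯` -/

/-- The **Euler totient of an ideal** as a real number: `φ(𝔲) = N𝔲 ∏_{P ∣ 𝔲}(1 − 1/NP)`
(`= #(𝓞_K/𝔲)ˣ`; `= ∏_{P∣𝔲}(NP − 1)` for square-free `𝔲`). [folklore] -/
def idealTotient (𝔲 : Ideal (𝓞 K)) : ℝ :=
  (Ideal.absNorm 𝔲 : ℝ) * ∏ P ∈ (normalizedFactors 𝔲).toFinset, (1 - 1 / (Ideal.absNorm P : ℝ))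

/-- The box `0 < N𝔯ᵢ ≤ R` (`i < k`) of the summation variables (nonzero ideals of norm `≤ R`; the
support condition `∏ N𝔯ᵢ ≤ R` lives inside it through the cut-off of `F` to `R_k`). [folklore] -/
def box (k : ℕ) (R : ℝ) : Finset (Fin k → Ideal (𝓞 K)) :=
  Fintype.piFinset fun _ : Fin k => idealsLE K R

/-- **The Maynard–Tao sieve weights over `𝓞_K`** (Castillo et al. §2.2, following Maynard 2015
Prop. 4.1 with integers replaced by ideals and sizes by norms):
`λ_{𝔡₁,…,𝔡_k} = (∏ᵢ μ(𝔡ᵢ) N𝔡ᵢ) ∑_{𝔯 : 𝔡ᵢ ∣ 𝔯ᵢ, (𝔯ᵢ, 𝔴) = 1 ∀ i} μ(∏ᵢ 𝔯ᵢ)²/(∏ᵢ φ(𝔯ᵢ)) ·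
F(log N𝔯₁/log R, …, log N𝔯_k/log R)`, the `𝔯ᵢ` in the box `0 < N𝔯ᵢ ≤ R` and `F` cut off to the
simplex `R_k`. [cite: CastilloEtAl2015, §2.2 (the weights λ_{𝔡₁,…,𝔡_k} and y_{𝔯₁,…,𝔯_k})] -/
def weight (k : ℕ) (F : (Fin k → ℝ) → ℝ) (R : ℝ) (𝔴 : Ideal (𝓞 K)) (𝔡 : Fin k → Ideal (𝓞 K)) : ℝ :=
  (∏ i, (idealMoebius (𝔡 i) : ℝ) * (Ideal.absNorm (𝔡 i) : ℝ)) *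
    ∑ 𝔯 ∈ (box K k R).filter (fun 𝔯 => ∀ i, 𝔡 i ∣ 𝔯 i ∧ 𝔯 i ⊔ 𝔴 = ⊤),
      (idealMoebius (∏ i, 𝔯 i) : ℝ) ^ 2 / (∏ i, idealTotient K (𝔯 i)) *
        (maynardSimplex k).indicator F (fun i => Real.log (Ideal.absNorm (𝔯 i)) / Real.log R)

/-- Maynard's variables `y_{𝔯₁,…,𝔯_k} = (∏ᵢ μ(𝔯ᵢ) φ(𝔯ᵢ)) ∑_{𝔡 : 𝔯ᵢ ∣ 𝔡ᵢ ∀ i} λ_𝔡/∏ᵢ N𝔡ᵢ` over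
`𝓞_K`, the `𝔡ᵢ` running over the box. [cite: CastilloEtAl2015, §2.2] -/
def Y (k : ℕ) (F : (Fin k → ℝ) → ℝ) (R : ℝ) (𝔴 : Ideal (𝓞 K)) (𝔯 : Fin k → Ideal (𝓞 K)) : ℝ :=
  (∏ i, (idealMoebius (𝔯 i) : ℝ) * idealTotient K (𝔯 i)) *
    ∑ 𝔡 ∈ (box K k R).filter (fun 𝔡 => ∀ i, 𝔯 i ∣ 𝔡 i),
      weight K k F R 𝔴 𝔡 / ∏ i, (Ideal.absNorm (𝔡 i) : ℝ)

variable {K}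

/-- Membership in the box. [folklore] -/
theorem mem_box_iff {k : ℕ} {R : ℝ} {𝔯 : Fin k → Ideal (𝓞 K)} :
    𝔯 ∈ box K k R ↔ ∀ i, 𝔯 i ≠ ⊥ ∧ (Ideal.absNorm (𝔯 i) : ℝ) ≤ R := by
  simp [box, Fintype.mem_piFinset, mem_idealsLE]

/-- `φ(𝔲) > 0` for `𝔲 ≠ 0`. [folklore] -/
theorem idealTotient_pos {𝔲 : Ideal (𝓞 K)} (h𝔲 : 𝔲 ≠ ⊥) : 0 < idealTotient K 𝔲 := by
  have hN : (0 : ℝ) < Ideal.absNorm 𝔲 := by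
    exact_mod_cast Nat.pos_of_ne_zero (by rwa [Ne, Ideal.absNorm_eq_zero_iff])
  refine mul_pos hN (Finset.prod_pos fun P hP => ?_)
  have h2 : (2 : ℝ) ≤ Ideal.absNorm P := by
    exact_mod_cast two_le_absNorm_of_prime (prime_of_normalized_factor P (Multiset.mem_toFinset.1 hP))
  have : 1 / (Ideal.absNorm P : ℝ) ≤ 1 / 2 := by
    rw [div_le_div_iff₀ (by linarith) two_pos]; linarith
  linarith

/-- On square-free ideals `φ(𝔲) = ∏_{P∣𝔲}(NP − 1)`. [folklore] -/
theorem idealTotient_of_squarefree {𝔲 : Ideal (𝓞 K)} (hsq : Squarefree 𝔲) :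
    idealTotient K 𝔲 = ∏ P ∈ (normalizedFactors 𝔲).toFinset, ((Ideal.absNorm P : ℝ) - 1) := by
  have h𝔲0 : (𝔲 : Ideal (𝓞 K)) ≠ 0 := hsq.ne_zero
  have h𝔲 : 𝔲 ≠ ⊥ := by rwa [Ne, ← Ideal.zero_eq_bot]
  have hnd := (squarefree_iff_nodup_normalizedFactors h𝔲0).1 hsq
  rw [idealTotient, Literature.NumberTheory.Sieve.IdealSieve.absNorm_eq_prod_pow h𝔲,
    ← Finset.prod_mul_distrib]
  refine Finset.prod_congr rfl fun P hP => ?_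
  have h1 : Multiset.count P (normalizedFactors 𝔲) = 1 := by
    have := Multiset.nodup_iff_count_le_one.1 hnd P
    have := Multiset.one_le_count_iff_mem.2 (Multiset.mem_toFinset.1 hP)
    omega
  have hN0 : (Ideal.absNorm P : ℝ) ≠ 0 := by
    have h2 : (2 : ℝ) ≤ Ideal.absNorm P := by
      exact_mod_cast two_le_absNorm_of_prime (prime_of_normalized_factor P (Multiset.mem_toFinset.1 hP))
    linarith
  rw [h1, pow_one]
  field_simp

/-- **`∑_{𝔡 ∣ 𝔫} φ(𝔡) = N𝔫`** over `𝓞_K` (`𝔫 ≠ 0`): `φ = ppMul b` with `b(P, j) = NP^j − NP^{j−1}`, and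
`1 + ∑_{1≤j≤v}(NP^j − NP^{j−1}) = NP^v` (Maynard's (5.5) ingredient `1/[d,e] = (1/de)∑_{u∣(d,e)} φ(u)`
over ideals rests on this). [folklore] -/
theorem sum_divisors_idealTotient {𝔫 : Ideal (𝓞 K)} (h𝔫 : 𝔫 ≠ ⊥) {D : Finset (Ideal (𝓞 K))}
    (hD : ∀ 𝔡, 𝔡 ∈ D ↔ 𝔡 ∣ 𝔫) : ∑ 𝔡 ∈ D, idealTotient K 𝔡 = (Ideal.absNorm 𝔫 : ℝ) := by
  set b : Ideal (𝓞 K) → ℕ → ℝ := fun P j =>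
    (Ideal.absNorm P : ℝ) ^ j - (Ideal.absNorm P : ℝ) ^ (j - 1) with hb
  have hφ : ∀ 𝔡 : Ideal (𝓞 K), 𝔡 ≠ ⊥ → idealTotient K 𝔡 = ppMul b 𝔡 := by
    intro 𝔡 h𝔡
    rw [idealTotient, Literature.NumberTheory.Sieve.IdealSieve.absNorm_eq_prod_pow h𝔡, ppMul,
      ← Finset.prod_mul_distrib]
    refine Finset.prod_congr rfl fun P hP => ?_
    have hv : 1 ≤ Multiset.count P (normalizedFactors 𝔡) :=
      Multiset.one_le_count_iff_mem.2 (Multiset.mem_toFinset.1 hP)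
    have hN0 : (Ideal.absNorm P : ℝ) ≠ 0 := by
      have h2 : (2 : ℝ) ≤ Ideal.absNorm P := by
        exact_mod_cast two_le_absNorm_of_prime (prime_of_normalized_factor P (Multiset.mem_toFinset.1 hP))
      linarith
    rw [hb]; dsimp only
    obtain ⟨v, hv'⟩ : ∃ v, Multiset.count P (normalizedFactors 𝔡) = v + 1 := ⟨_, (Nat.succ_pred_eq_of_pos hv).symm⟩
    rw [hv', Nat.add_sub_cancel, pow_succ]
    field_simp
  rw [Finset.sum_congr rfl fun 𝔡 h𝔡 => hφ 𝔡 (by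
      rintro rfl
      have := (hD ⊥).1 h𝔡
      rw [Ideal.dvd_iff_le, le_bot_iff] at this
      exact h𝔫 this),
    sum_divisors_ppMul b h𝔫 hD, Literature.NumberTheory.Sieve.IdealSieve.absNorm_eq_prod_pow h𝔫]
  refine Finset.prod_congr rfl fun P hP => ?_
  -- telescoping: `1 + ∑_{1 ≤ j ≤ v} (N^j − N^{j−1}) = N^v`
  have key : ∀ v : ℕ, ∑ j ∈ Finset.range (v + 1), (if j = 0 then (1 : ℝ) else b P j) =
      (Ideal.absNorm P : ℝ) ^ v := by
    intro v
    induction v with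
    | zero => simp
    | succ v ih =>
      rw [Finset.sum_range_succ, ih, if_neg (by omega), hb]
      dsimp only
      rw [Nat.add_sub_cancel]
      ring
  rw [key]

/-- `μ(𝔲)² = 1` for square-free `𝔲`. [folklore] -/
theorem idealMoebius_sq_of_squarefree {𝔲 : Ideal (𝓞 K)} (hsq : Squarefree 𝔲) :
    (idealMoebius 𝔲 : ℝ) ^ 2 = 1 := by
  rw [idealMoebius_apply_of_squarefree hsq]
  push_cast
  rw [← pow_mul, mul_comm, pow_mul]
  simp

/-- `λ_𝔡/∏ N𝔡ᵢ = (∏ μ(𝔡ᵢ)) · ∑_{𝔯 : 𝔡ᵢ ∣ 𝔯ᵢ, (𝔯ᵢ,𝔴)=1} μ(∏ 𝔯ᵢ)²/∏ φ(𝔯ᵢ) · F(log N𝔯ᵢ/log R)` for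
nonzero `𝔡ᵢ`. [cite: CastilloEtAl2015, §2.2] -/
theorem weight_div_prod {k : ℕ} (F : (Fin k → ℝ) → ℝ) (R : ℝ) (𝔴 : Ideal (𝓞 K))
    {𝔡 : Fin k → Ideal (𝓞 K)} (hd : ∀ i, 𝔡 i ≠ ⊥) :
    weight K k F R 𝔴 𝔡 / ∏ i, (Ideal.absNorm (𝔡 i) : ℝ) =
      (∏ i, (idealMoebius (𝔡 i) : ℝ)) *
        ∑ 𝔯 ∈ (box K k R).filter (fun 𝔯 => ∀ i, 𝔡 i ∣ 𝔯 i ∧ 𝔯 i ⊔ 𝔴 = ⊤),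
          (idealMoebius (∏ i, 𝔯 i) : ℝ) ^ 2 / (∏ i, idealTotient K (𝔯 i)) *
            (maynardSimplex k).indicator F (fun i => Real.log (Ideal.absNorm (𝔯 i)) / Real.log R) := by
  have hprod : (∏ i, (Ideal.absNorm (𝔡 i) : ℝ)) ≠ 0 :=
    Finset.prod_ne_zero_iff.mpr fun i _ => by
      exact_mod_cast (Nat.pos_of_ne_zero (by rw [Ne, Ideal.absNorm_eq_zero_iff]; exact hd i)).ne'
  rw [weight, Finset.prod_mul_distrib, div_eq_iff hprod]
  ring

/-- The inner Möbius sum of the inversion factorises over the coordinates: for `𝔢` in the box,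
`∑_{𝔡 in the box : 𝔯ᵢ ∣ 𝔡ᵢ ∣ 𝔢ᵢ ∀ i} ∏ μ(𝔡ᵢ) = ∏ᵢ ∑_{𝔡ᵢ ∣ 𝔢ᵢ, 𝔯ᵢ ∣ 𝔡ᵢ} μ(𝔡ᵢ)`, the `i`-th divisor
sum running over `(idealsLE K R).filter (· ∣ 𝔢ᵢ)` (all divisors of `𝔢ᵢ`).
[cite: CastilloEtAl2015, §2.2] -/
theorem sum_ite_dvd_dvd_eq_prod {k : ℕ} {R : ℝ} (𝔯 𝔢 : Fin k → Ideal (𝓞 K)) (he : 𝔢 ∈ box K k R) :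
    ∑ 𝔡 ∈ box K k R,
        (if (∀ i, 𝔯 i ∣ 𝔡 i) ∧ (∀ i, 𝔡 i ∣ 𝔢 i) then ∏ i, (idealMoebius (𝔡 i) : ℝ) else 0) =
      ∏ i, ∑ 𝔡 ∈ ((idealsLE K R).filter (· ∣ 𝔢 i)).filter (fun 𝔡 => 𝔯 i ∣ 𝔡),
        (idealMoebius 𝔡 : ℝ) := by
  rw [Finset.prod_univ_sum, ← Finset.sum_filter]
  have he' := mem_box_iff.mp he
  apply Finset.sum_congr
  · ext 𝔡
    simp only [Finset.mem_filter, box, Fintype.mem_piFinset, mem_idealsLE]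
    constructor
    · rintro ⟨-, hrd, hde⟩ i
      have h𝔡0 : 𝔡 i ≠ ⊥ := by
        intro h0
        have := hde i
        rw [h0, Ideal.dvd_iff_le, le_bot_iff] at this
        exact (he' i).1 this
      refine ⟨⟨⟨h𝔡0, le_trans ?_ (he' i).2⟩, hde i⟩, hrd i⟩
      have hN : Ideal.absNorm (𝔢 i) ≠ 0 := by rw [Ne, Ideal.absNorm_eq_zero_iff]; exact (he' i).1
      exact_mod_cast Nat.le_of_dvd (Nat.pos_of_ne_zero hN) (map_dvd _ (hde i))
    · intro h
      exact ⟨fun i => (h i).1.1, fun i => (h i).2, fun i => (h i).1.2⟩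
  · intro 𝔡 _
    rfl

/-- For `∏ 𝔢ᵢ` square-free (and `𝔢` in the box),
`∏ᵢ ∑_{𝔡ᵢ ∣ 𝔢ᵢ, 𝔯ᵢ ∣ 𝔡ᵢ} μ(𝔡ᵢ) = [𝔢 = 𝔯] · ∏ μ(𝔯ᵢ)`. [cite: CastilloEtAl2015, §2.2] -/
theorem prod_sum_moebius_filter_eq {k : ℕ} {R : ℝ} (𝔯 𝔢 : Fin k → Ideal (𝓞 K))
    (he : 𝔢 ∈ box K k R) (hsq : Squarefree (∏ i, 𝔢 i)) :
    ∏ i, ∑ 𝔡 ∈ ((idealsLE K R).filter (· ∣ 𝔢 i)).filter (fun 𝔡 => 𝔯 i ∣ 𝔡),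
        (idealMoebius 𝔡 : ℝ) =
      if 𝔢 = 𝔯 then ∏ i, (idealMoebius (𝔯 i) : ℝ) else 0 := by
  have he' := mem_box_iff.mp he
  have hsqi : ∀ i, Squarefree (𝔢 i) := fun i =>
    hsq.squarefree_of_dvd (Finset.dvd_prod_of_mem _ (Finset.mem_univ i))
  have hD : ∀ i, ∀ 𝔡, 𝔡 ∈ (idealsLE K R).filter (· ∣ 𝔢 i) ↔ 𝔡 ∣ 𝔢 i := by
    intro i 𝔡
    rw [Finset.mem_filter, mem_idealsLE]
    constructor
    · exact fun h => h.2
    · intro h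
      have h𝔡0 : 𝔡 ≠ ⊥ := by
        intro h0; rw [h0, Ideal.dvd_iff_le, le_bot_iff] at h; exact (he' i).1 h
      refine ⟨⟨h𝔡0, le_trans ?_ (he' i).2⟩, h⟩
      have hN : Ideal.absNorm (𝔢 i) ≠ 0 := by rw [Ne, Ideal.absNorm_eq_zero_iff]; exact (he' i).1
      exact_mod_cast Nat.le_of_dvd (Nat.pos_of_ne_zero hN) (map_dvd _ h)
  have hcoord : ∀ i, ∑ 𝔡 ∈ ((idealsLE K R).filter (· ∣ 𝔢 i)).filter (fun 𝔡 => 𝔯 i ∣ 𝔡),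
      (idealMoebius 𝔡 : ℝ) = if 𝔢 i = 𝔯 i then (idealMoebius (𝔯 i) : ℝ) else 0 := by
    intro i
    have h := sum_idealMoebius_filter_dvd_of_squarefree (hsqi i) (𝔯 i) (hD i)
    have h' := congrArg (fun z : ℤ => (z : ℝ)) h
    simp only [Int.cast_sum] at h'
    rw [h']
    split_ifs <;> simp
  simp_rw [hcoord]
  by_cases h : 𝔢 = 𝔯
  · subst h; simp
  · rw [if_neg h]
    obtain ⟨i, hi⟩ : ∃ i, 𝔢 i ≠ 𝔯 i := by
      by_contra hall
      push Not at hall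
      exact h (funext hall)
    exact Finset.prod_eq_zero (Finset.mem_univ i) (if_neg hi)

/-- **Maynard's `y` recovered from `λ`, over `𝓞_K`** ("this change is invertible"): for `𝔯` in the
box, `y_𝔯 = μ(∏ 𝔯ᵢ)² · 1[(𝔯ᵢ, 𝔴) = 1 ∀ i] · F(log N𝔯₁/log R, …, log N𝔯_k/log R)` (with `F` cut off
to `R_k`). The finite Möbius inversion of Maynard's Lemma 5.1: swap the sums, factor the inner sum
over the coordinates, and use `∑_{𝔡 ∣ 𝔫, 𝔯 ∣ 𝔡} μ(𝔡) = μ(𝔯)[𝔫 = 𝔯]` for square-free `𝔫`.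
[cite: CastilloEtAl2015, §2.2 (y_{𝔯₁,…,𝔯_k} = F(log N𝔯ᵢ/log R) on square-free 𝔯 coprime to 𝔴)] -/
theorem Y_eq {k : ℕ} (F : (Fin k → ℝ) → ℝ) (R : ℝ) (𝔴 : Ideal (𝓞 K)) {𝔯 : Fin k → Ideal (𝓞 K)}
    (hr : 𝔯 ∈ box K k R) :
    Y K k F R 𝔴 𝔯 =
      if (∀ i, 𝔯 i ⊔ 𝔴 = ⊤) then
        (idealMoebius (∏ i, 𝔯 i) : ℝ) ^ 2 *
          (maynardSimplex k).indicator F (fun i => Real.log (Ideal.absNorm (𝔯 i)) / Real.log R)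
      else 0 := by
  have hr' := mem_box_iff.mp hr
  -- abbreviations
  set Box := box K k R with hBox
  set c : (Fin k → Ideal (𝓞 K)) → ℝ := fun 𝔢 =>
    (idealMoebius (∏ i, 𝔢 i) : ℝ) ^ 2 / (∏ i, idealTotient K (𝔢 i)) *
      (maynardSimplex k).indicator F (fun i => Real.log (Ideal.absNorm (𝔢 i)) / Real.log R) with hc
  -- Step A: rewrite `λ_𝔡/∏ N𝔡ᵢ`
  have hA : ∀ 𝔡 ∈ Box.filter (fun 𝔡 => ∀ i, 𝔯 i ∣ 𝔡 i),
      weight K k F R 𝔴 𝔡 / ∏ i, (Ideal.absNorm (𝔡 i) : ℝ) =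
        (∏ i, (idealMoebius (𝔡 i) : ℝ)) *
          ∑ 𝔢 ∈ Box.filter (fun 𝔢 => ∀ i, 𝔡 i ∣ 𝔢 i ∧ 𝔢 i ⊔ 𝔴 = ⊤), c 𝔢 := by
    intro 𝔡 hd
    have hd' := mem_box_iff.mp (Finset.mem_filter.mp hd).1
    exact weight_div_prod F R 𝔴 fun i => (hd' i).1
  unfold Y
  rw [Finset.sum_congr rfl hA]
  -- Step B: swap the sums
  set g : (Fin k → Ideal (𝓞 K)) → (Fin k → Ideal (𝓞 K)) → ℝ := fun 𝔡 𝔢 =>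
    if (∀ i, 𝔯 i ∣ 𝔡 i) ∧ (∀ i, 𝔡 i ∣ 𝔢 i) ∧ (∀ i, 𝔢 i ⊔ 𝔴 = ⊤) then
      (∏ i, (idealMoebius (𝔡 i) : ℝ)) * c 𝔢 else 0 with hg
  have hB1 : ∑ 𝔡 ∈ Box.filter (fun 𝔡 => ∀ i, 𝔯 i ∣ 𝔡 i),
      (∏ i, (idealMoebius (𝔡 i) : ℝ)) *
        ∑ 𝔢 ∈ Box.filter (fun 𝔢 => ∀ i, 𝔡 i ∣ 𝔢 i ∧ 𝔢 i ⊔ 𝔴 = ⊤), c 𝔢 =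
      ∑ 𝔡 ∈ Box, ∑ 𝔢 ∈ Box, g 𝔡 𝔢 := by
    rw [Finset.sum_filter]
    refine Finset.sum_congr rfl fun 𝔡 _ => ?_
    by_cases h1 : ∀ i, 𝔯 i ∣ 𝔡 i
    · rw [if_pos h1, Finset.mul_sum, Finset.sum_filter]
      refine Finset.sum_congr rfl fun 𝔢 _ => ?_
      by_cases h2 : ∀ i, 𝔡 i ∣ 𝔢 i ∧ 𝔢 i ⊔ 𝔴 = ⊤
      · simp [hg, h1, h2]
      · have : ¬ ((∀ i, 𝔯 i ∣ 𝔡 i) ∧ (∀ i, 𝔡 i ∣ 𝔢 i) ∧ (∀ i, 𝔢 i ⊔ 𝔴 = ⊤)) :=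
          fun h => h2 fun i => ⟨h.2.1 i, h.2.2 i⟩
        simp [hg, h2, this]
    · rw [if_neg h1]
      refine (Finset.sum_eq_zero fun 𝔢 _ => ?_).symm
      simp [hg, h1]
  have hB2 : ∑ 𝔢 ∈ Box, (if (∀ i, 𝔢 i ⊔ 𝔴 = ⊤) then
        c 𝔢 * ∑ 𝔡 ∈ Box, (if (∀ i, 𝔯 i ∣ 𝔡 i) ∧ (∀ i, 𝔡 i ∣ 𝔢 i) then
          ∏ i, (idealMoebius (𝔡 i) : ℝ) else 0)
        else 0) = ∑ 𝔢 ∈ Box, ∑ 𝔡 ∈ Box, g 𝔡 𝔢 := by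
    refine Finset.sum_congr rfl fun 𝔢 _ => ?_
    by_cases h3 : ∀ i, 𝔢 i ⊔ 𝔴 = ⊤
    · rw [if_pos h3, Finset.mul_sum]
      refine Finset.sum_congr rfl fun 𝔡 _ => ?_
      by_cases h12 : (∀ i, 𝔯 i ∣ 𝔡 i) ∧ (∀ i, 𝔡 i ∣ 𝔢 i)
      · simp [hg, h12, h3, mul_comm]
      · have : ¬ ((∀ i, 𝔯 i ∣ 𝔡 i) ∧ (∀ i, 𝔡 i ∣ 𝔢 i) ∧ (∀ i, 𝔢 i ⊔ 𝔴 = ⊤)) :=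
          fun h => h12 ⟨h.1, h.2.1⟩
        simp [hg, h12, this]
    · rw [if_neg h3]
      refine (Finset.sum_eq_zero fun 𝔡 _ => ?_).symm
      simp [hg, h3]
  have hB : ∑ 𝔡 ∈ Box.filter (fun 𝔡 => ∀ i, 𝔯 i ∣ 𝔡 i),
      (∏ i, (idealMoebius (𝔡 i) : ℝ)) *
        ∑ 𝔢 ∈ Box.filter (fun 𝔢 => ∀ i, 𝔡 i ∣ 𝔢 i ∧ 𝔢 i ⊔ 𝔴 = ⊤), c 𝔢 =
      ∑ 𝔢 ∈ Box, if (∀ i, 𝔢 i ⊔ 𝔴 = ⊤) then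
        c 𝔢 * ∑ 𝔡 ∈ Box, (if (∀ i, 𝔯 i ∣ 𝔡 i) ∧ (∀ i, 𝔡 i ∣ 𝔢 i) then
          ∏ i, (idealMoebius (𝔡 i) : ℝ) else 0)
        else 0 := by
    rw [hB1, hB2, Finset.sum_comm]
  rw [hB]
  -- Step C/D: evaluate the inner sums and collapse to `𝔢 = 𝔯`
  have hCD : ∀ 𝔢 ∈ Box, (if (∀ i, 𝔢 i ⊔ 𝔴 = ⊤) then
        c 𝔢 * ∑ 𝔡 ∈ Box, (if (∀ i, 𝔯 i ∣ 𝔡 i) ∧ (∀ i, 𝔡 i ∣ 𝔢 i) then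
          ∏ i, (idealMoebius (𝔡 i) : ℝ) else 0)
        else 0) =
      if 𝔢 = 𝔯 then (if (∀ i, 𝔯 i ⊔ 𝔴 = ⊤) then c 𝔯 * ∏ i, (idealMoebius (𝔯 i) : ℝ) else 0)
        else 0 := by
    intro 𝔢 he
    rw [sum_ite_dvd_dvd_eq_prod 𝔯 𝔢 he]
    by_cases hsq : Squarefree (∏ i, 𝔢 i)
    · rw [prod_sum_moebius_filter_eq 𝔯 𝔢 he hsq]
      by_cases h : 𝔢 = 𝔯
      · subst h; simp
      · simp [h]
    · -- `c 𝔢 = 0`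
      have hce : c 𝔢 = 0 := by
        simp only [hc, idealMoebius_apply_of_not_squarefree hsq, Int.cast_zero,
          zero_pow two_ne_zero, zero_div, zero_mul]
      by_cases h : 𝔢 = 𝔯
      · subst h
        simp [hce]
      · simp [hce, h]
  rw [Finset.sum_congr rfl hCD, Finset.sum_ite_eq' Box 𝔯, if_pos hr]
  -- Step F: the algebra at `𝔢 = 𝔯`
  split_ifs with hcop
  · simp only [hc]
    have hφ : (∏ i, idealTotient K (𝔯 i)) ≠ 0 :=
      Finset.prod_ne_zero_iff.mpr fun i _ => (idealTotient_pos (hr' i).1).ne'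
    have hrew : (∏ i, (idealMoebius (𝔯 i) : ℝ) * idealTotient K (𝔯 i)) *
        ((idealMoebius (∏ i, 𝔯 i) : ℝ) ^ 2 / (∏ i, idealTotient K (𝔯 i)) *
          (maynardSimplex k).indicator F (fun i => Real.log (Ideal.absNorm (𝔯 i)) / Real.log R) *
          ∏ i, (idealMoebius (𝔯 i) : ℝ)) =
        (∏ i, (idealMoebius (𝔯 i) : ℝ)) ^ 2 * ((idealMoebius (∏ i, 𝔯 i) : ℝ) ^ 2 *
          (maynardSimplex k).indicator F (fun i => Real.log (Ideal.absNorm (𝔯 i)) / Real.log R)) := by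
      rw [Finset.prod_mul_distrib]
      field_simp
    rw [hrew]
    by_cases hsq : Squarefree (∏ i, 𝔯 i)
    · have hsqi : ∀ i, Squarefree (𝔯 i) := fun i =>
        hsq.squarefree_of_dvd (Finset.dvd_prod_of_mem _ (Finset.mem_univ i))
      have hμprod : (∏ i, (idealMoebius (𝔯 i) : ℝ)) ^ 2 = 1 := by
        rw [← Finset.prod_pow]
        exact Finset.prod_eq_one fun i _ => idealMoebius_sq_of_squarefree (hsqi i)
      rw [hμprod, one_mul]
    · simp [idealMoebius_apply_of_not_squarefree hsq]
  · simp

/-- Outside the box `y_𝔯 = 0`: no `𝔡` in the box is a multiple of `𝔯`. [cite: CastilloEtAl2015, §2.2] -/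
theorem Y_eq_zero_of_not_mem {k : ℕ} (F : (Fin k → ℝ) → ℝ) (R : ℝ) (𝔴 : Ideal (𝓞 K))
    {𝔯 : Fin k → Ideal (𝓞 K)} (hr : 𝔯 ∉ box K k R) : Y K k F R 𝔴 𝔯 = 0 := by
  unfold Y
  have hempty : (box K k R).filter (fun 𝔡 => ∀ i, 𝔯 i ∣ 𝔡 i) = ∅ := by
    ext 𝔡
    simp only [Finset.mem_filter, Finset.notMem_empty, iff_false, not_and]
    intro hd hdiv
    apply hr
    rw [mem_box_iff] at hd ⊢
    intro i
    obtain ⟨h1, h2⟩ := hd i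
    have h𝔯0 : 𝔯 i ≠ ⊥ := by
      intro h0
      have := hdiv i
      rw [h0, Ideal.dvd_iff_le, le_bot_iff] at this
      exact h1 this
    refine ⟨h𝔯0, le_trans ?_ h2⟩
    have hN : Ideal.absNorm (𝔡 i) ≠ 0 := by rw [Ne, Ideal.absNorm_eq_zero_iff]; exact h1
    exact_mod_cast Nat.le_of_dvd (Nat.pos_of_ne_zero hN) (map_dvd _ (hdiv i))
  rw [hempty, Finset.sum_empty, mul_zero]

end Literature.NumberTheory.Sieve.MaynardNF
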